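import Mathlib.Analysis.SpecialFunctions.Complex.Circle
import Mathlib.Analysis.SpecialFunctions.Trigonometric.Arctan
import HarnessLib

/-!
# Separation of the two plumbing points in quarter-arc coordinates

Topic `Literature/Topology/FourManifolds` (fact seat of the Seiberg–Witten leaf
`Literature.Barriers.SmoothPoincare4.akhmedovPark2010_lemma8_invariants`; block 2 of
Akhmedov–Park's `X₁(m)`, A. Akhmedov, B. D. Park, Invent. Math. 181 (2010), §3).  The two plumbing
points `x₂ = (1, 1)`, `x₃ = (e^{-2 i r₀}, 1)` of the torus `S₁ = T × {y₀}` with the braided torus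
lie `2 r₀` apart in the first circle factor; the local models at them live in the quarter-arc
charts `a = c′ · Im((z θ⁻¹)²)/Re((z θ⁻¹)²)` centred at `x₂` resp. `x₃`
(`TorusQuarterChart.lean`).  The injectivity of the assembled tube of `Σ̄₂` uses that a point close
to one of them is FAR in the chart of the other.  This file proves the underlying facts about the
circle:

* `re_sq_pos_and_tan_le_abs_quarterCoord` — if `Re (z φ⁻¹) ≥ cos ε` for `φ = θ e^{iα}` with
  `ε < |α|`, `|α| + ε < π/4`, then `z` lies in the quarter arc about `θ` (`Re (z θ⁻¹)² > 0`,
  `Re (z θ⁻¹) > 0`) and its quarter coordinate is large: `tan (2(|α| - ε)) ≤ |Im (z θ⁻¹)²/Re (z θ⁻¹)²|`;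
* `re_mul_circleExp_ge_cos` — a point of the arc `θ e^{is}`, `|s| ≤ S ≤ π`, satisfies
  `Re (z θ⁻¹) ≥ cos S`;
* `im_sq_div_re_sq_circleExp_half` — the quarter coordinate of `e^{i s/2}` is `tan s` (`|s| < π/2`),
  with the bound `|tan (δ arctan t)| ≤ tan (δ π/2)` used for the thin arcs of the braided torus
  (`abs_tan_mul_arctan_le`).

Everything is proved; no definitions.

## References

* A. Akhmedov, B. D. Park, Invent. Math. 181 (2010) 577–603 = arXiv:math/0701829, §3. [AkhmedovPark2010]
-/

noncomputable section

open scoped Real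
open Complex

namespace Literature.Topology.FourManifolds

namespace QuarterSeparation

/-- Real and imaginary parts of a point of the circle written through its argument. [folklore] -/
theorem coe_eq_exp_arg (w : Circle) :
    ((w : ℂ)).re = Real.cos (arg (w : ℂ)) ∧ ((w : ℂ)).im = Real.sin (arg (w : ℂ)) ∧
      (((w : ℂ)) ^ 2).re = Real.cos (2 * arg (w : ℂ)) ∧ (((w : ℂ)) ^ 2).im = Real.sin (2 * arg (w : ℂ)) := by
  set u : ℝ := arg (w : ℂ) with hu
  have hw : (w : ℂ) = Complex.exp (u * I) := by
    have h := congrArg (fun z : Circle => (z : ℂ)) (Circle.exp_arg w)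
    simp only [Circle.coe_exp] at h
    rw [← hu] at h
    exact h.symm
  have hw2 : ((w : ℂ)) ^ 2 = Complex.exp ((2 * u : ℝ) * I) := by
    rw [hw, sq, ← Complex.exp_add]
    congr 1; push_cast; ring
  refine ⟨?_, ?_, ?_, ?_⟩
  · rw [hw]; exact Complex.exp_ofReal_mul_I_re _
  · rw [hw]; exact Complex.exp_ofReal_mul_I_im _
  · rw [hw2]; exact Complex.exp_ofReal_mul_I_re _
  · rw [hw2]; exact Complex.exp_ofReal_mul_I_im _

/-- `Re (w e^{-iα}) = cos (arg w - α)`. [folklore] -/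
theorem re_mul_exp_neg (w : Circle) (α : ℝ) :
    (((w * (Circle.exp α)⁻¹ : Circle)) : ℂ).re = Real.cos (arg (w : ℂ) - α) := by
  set u : ℝ := arg (w : ℂ) with hu
  have hw : (w : ℂ) = Complex.exp (u * I) := by
    have h := congrArg (fun z : Circle => (z : ℂ)) (Circle.exp_arg w)
    simp only [Circle.coe_exp] at h
    rw [← hu] at h
    exact h.symm
  have : (((w * (Circle.exp α)⁻¹ : Circle)) : ℂ) = Complex.exp (((u - α : ℝ)) * I) := by
    rw [Circle.coe_mul, Circle.coe_inv, Circle.coe_exp, hw, ← Complex.exp_neg, ← Complex.exp_add]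
    congr 1; push_cast; ring
  rw [this]; exact Complex.exp_ofReal_mul_I_re _

/-- **Separation in quarter-arc coordinates.**  Let `φ = θ e^{iα}` and `Re (z φ⁻¹) ≥ cos ε` with
`0 ≤ ε < |α|`, `|α| + ε < π/4`.  Then `z` lies in the quarter arc about `θ` and its quarter coordinate
satisfies `tan (2 (|α| - ε)) ≤ |Im ((z θ⁻¹)²)/Re ((z θ⁻¹)²)|`. [folklore] -/
theorem re_sq_pos_and_tan_le_abs_quarterCoord {θ z : Circle} {α ε : ℝ} (hε : 0 ≤ ε) (hεα : ε < |α|)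
    (hαε : |α| + ε < π / 4)
    (hz : Real.cos ε ≤ (((z * (θ * Circle.exp α)⁻¹ : Circle)) : ℂ).re) :
    0 < (((z * θ⁻¹ : Circle)) : ℂ).re ∧ 0 < ((((z * θ⁻¹ : Circle)) : ℂ) ^ 2).re ∧
      Real.tan (2 * (|α| - ε)) ≤
        |((((z * θ⁻¹ : Circle)) : ℂ) ^ 2).im / ((((z * θ⁻¹ : Circle)) : ℂ) ^ 2).re| := by
  set w : Circle := z * θ⁻¹ with hw
  set u : ℝ := arg (w : ℂ) with hu
  have hπ := Real.pi_pos
  -- `Re (z φ⁻¹) = cos (u - α)`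
  have hre : (((z * (θ * Circle.exp α)⁻¹ : Circle)) : ℂ).re = Real.cos (u - α) := by
    have : z * (θ * Circle.exp α)⁻¹ = w * (Circle.exp α)⁻¹ := by
      rw [hw, mul_inv, mul_assoc]
    rw [this]; exact re_mul_exp_neg w α
  rw [hre] at hz
  -- hence `|u - α| ≤ ε`
  have hu1 : -π < u := Complex.neg_pi_lt_arg _
  have hu2 : u ≤ π := Complex.arg_le_pi _
  have hα4 : |α| < π / 4 := by linarith
  have hαb := abs_lt.1 hα4
  have hcosε : Real.cos (3 * π / 4) < Real.cos ε := by
    apply Real.cos_lt_cos_of_nonneg_of_le_pi hε (by linarith)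
    linarith
  have hdiff : |u - α| ≤ ε := by
    -- first `|u - α| ≤ π` (otherwise `cos (u - α) < cos ε`)
    have hle : |u - α| ≤ π := by
      by_contra h
      push Not at h
      -- then `u - α ∈ (-5π/4, -π)`, `cos (u - α) = cos (-(u-α)) ≤ cos (3π/4)`? : use `|u - α| ∈ (π, 5π/4)`
      have h1 : π < |u - α| := h
      have h2 : |u - α| < 5 * π / 4 := by
        rw [abs_lt]; constructor <;> linarith
      have hc : Real.cos (u - α) = Real.cos (2 * π - |u - α|) := by
        rw [← Real.cos_abs (u - α), Real.cos_two_pi_sub]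
      have h3 : Real.cos (2 * π - |u - α|) < Real.cos (3 * π / 4) := by
        apply Real.cos_lt_cos_of_nonneg_of_le_pi (by linarith) (by linarith)
        linarith
      linarith
    by_contra h
    push Not at h
    have : Real.cos (|u - α|) < Real.cos ε :=
      Real.cos_lt_cos_of_nonneg_of_le_pi hε hle h
    rw [Real.cos_abs] at this
    linarith
  obtain ⟨hd1, hd2⟩ := abs_le.1 hdiff
  -- so `|u| ∈ [|α| - ε, |α| + ε] ⊆ (0, π/4)`
  have hu_lo : |α| - ε ≤ |u| := by
    have := abs_sub_abs_le_abs_sub α u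
    rw [abs_sub_comm] at this
    linarith
  have hu_hi : |u| ≤ |α| + ε := by
    have := abs_sub_abs_le_abs_sub u α
    linarith
  have hu_pos : 0 < |u| := lt_of_lt_of_le (by linarith) hu_lo
  have hu4 : |u| < π / 4 := lt_of_le_of_lt hu_hi hαε
  obtain ⟨hwre, -, hw2re, hw2im⟩ := coe_eq_exp_arg w
  rw [← hu] at hwre hw2re hw2im
  have hub := abs_lt.1 hu4
  refine ⟨?_, ?_, ?_⟩
  · rw [hwre, ← Real.cos_abs]
    exact Real.cos_pos_of_mem_Ioo ⟨by linarith, by linarith⟩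
  · rw [hw2re, ← Real.cos_abs, abs_mul, abs_two]
    exact Real.cos_pos_of_mem_Ioo ⟨by linarith, by linarith⟩
  · rw [hw2re, hw2im, ← Real.tan_eq_sin_div_cos]
    have htan : |Real.tan (2 * u)| = Real.tan (2 * |u|) := by
      rcases le_or_gt 0 u with h | h
      · rw [abs_of_nonneg h, abs_of_nonneg]
        exact Real.tan_nonneg_of_nonneg_of_le_pi_div_two (by linarith) (by linarith)
      · have hneg : Real.tan (2 * u) < 0 :=
          Real.tan_neg_of_neg_of_pi_div_two_lt (by linarith) (by linarith)
        rw [abs_of_neg h, abs_of_neg hneg, mul_neg, Real.tan_neg]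
    rw [htan]
    rcases eq_or_lt_of_le hu_lo with h | h
    · rw [h]
    · exact (Real.tan_lt_tan_of_lt_of_lt_pi_div_two (by linarith) (by linarith) (by linarith)).le

/-- **Points of a short arc stay close**: `Re ((θ e^{is}) θ⁻¹) ≥ cos S` for `|s| ≤ S ≤ π`. [folklore] -/
theorem re_mul_circleExp_ge_cos {θ : Circle} {s S : ℝ} (hs : |s| ≤ S) (hS : S ≤ π) :
    Real.cos S ≤ ((((θ * Circle.exp s) * θ⁻¹ : Circle)) : ℂ).re := by
  rw [mul_inv_cancel_comm, Circle.coe_exp, Complex.exp_ofReal_mul_I_re, ← Real.cos_abs s]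
  exact Real.cos_le_cos_of_nonneg_of_le_pi (abs_nonneg s) hS hs

/-- **The quarter coordinate of `e^{i s/2}` is `tan s`** (`|s| < π/2` not even needed for the
identity). [folklore] -/
theorem im_sq_div_re_sq_circleExp_half (s : ℝ) :
    (((Circle.exp (s / 2) : Circle) : ℂ) ^ 2).im / (((Circle.exp (s / 2) : Circle) : ℂ) ^ 2).re =
      Real.tan s := by
  have : ((Circle.exp (s / 2) : Circle) : ℂ) ^ 2 = ((Circle.exp s : Circle) : ℂ) := by
    rw [sq, ← Circle.coe_mul, ← Circle.exp_add, add_halves]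
  rw [this, Circle.coe_exp, Complex.exp_ofReal_mul_I_re, Complex.exp_ofReal_mul_I_im,
    Real.tan_eq_sin_div_cos]

/-- The real part of `(e^{i s/2})²` is positive for `|s| < π/2` (so the point lies in the quarter
arc). [folklore] -/
theorem re_sq_circleExp_half_pos {s : ℝ} (hs : |s| < π / 2) :
    0 < (((Circle.exp (s / 2) : Circle) : ℂ) ^ 2).re ∧ 0 < (((Circle.exp (s / 2) : Circle) : ℂ)).re := by
  have h2 : ((Circle.exp (s / 2) : Circle) : ℂ) ^ 2 = ((Circle.exp s : Circle) : ℂ) := by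
    rw [sq, ← Circle.coe_mul, ← Circle.exp_add, add_halves]
  obtain ⟨h1, h1'⟩ := abs_lt.1 hs
  have hπ := Real.pi_pos
  constructor
  · rw [h2, Circle.coe_exp, Complex.exp_ofReal_mul_I_re]
    exact Real.cos_pos_of_mem_Ioo ⟨by linarith, by linarith⟩
  · rw [Circle.coe_exp, Complex.exp_ofReal_mul_I_re]
    exact Real.cos_pos_of_mem_Ioo ⟨by linarith, by linarith⟩

/-- **Thin arcs have small quarter coordinates**: `|tan (δ arctan t)| ≤ tan (δ π/2)` for
`0 ≤ δ < 1`. [folklore] -/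
theorem abs_tan_mul_arctan_le {δ : ℝ} (hδ : 0 ≤ δ) (hδ1 : δ < 1) (t : ℝ) :
    |Real.tan (δ * Real.arctan t)| ≤ Real.tan (δ * (π / 2)) := by
  have hπ := Real.pi_pos
  have h1 := Real.arctan_lt_pi_div_two t
  have h2 := Real.neg_pi_div_two_lt_arctan t
  have hb : |δ * Real.arctan t| ≤ δ * (π / 2) := by
    rw [abs_mul, abs_of_nonneg hδ]
    exact mul_le_mul_of_nonneg_left (abs_le.2 ⟨by linarith, by linarith⟩) hδ
  have hlt : δ * (π / 2) < π / 2 := by nlinarith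
  have htan : |Real.tan (δ * Real.arctan t)| = Real.tan |δ * Real.arctan t| := by
    rcases le_or_gt 0 (δ * Real.arctan t) with h | h
    · rw [abs_of_nonneg h, abs_of_nonneg]
      exact Real.tan_nonneg_of_nonneg_of_le_pi_div_two h (by linarith [abs_le.1 hb])
    · have hneg : Real.tan (δ * Real.arctan t) < 0 :=
        Real.tan_neg_of_neg_of_pi_div_two_lt h (by have := (abs_le.1 hb).1; linarith)
      rw [abs_of_neg h, abs_of_neg hneg, Real.tan_neg]
  rw [htan]
  rcases eq_or_lt_of_le hb with h | h
  · rw [h]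
  · exact (Real.tan_lt_tan_of_lt_of_lt_pi_div_two (by linarith [abs_nonneg (δ * Real.arctan t)])
      hlt h).le

end QuarterSeparation

end Literature.Topology.FourManifolds
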